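import Summits.CriticalPhenomena.PercolationContinuityZ3.Theorems.PercNearOneGluingNoHeavyLowerTailSunflowerCoverGraded

/-!
# `NoHeavyLowerTail` (crux stmt-CriticalPhenomena-4575), abstract sunflower cubic: CORES WITH THREE MINIMAL TRANSVERSALS —
# SAFE ⟹ COVER (hence graded safety ⟺ safety there)

Support file (seat `prim-ineq-prove-1` gen 36; `--supports stmt-CriticalPhenomena-4575`).  No `sorry`, no named facts.
Memo: run/shared/lean/prim/prim-ineq-prove-1/FINDING-COVER-prove1-g36.md §5 (THEOREM 4).

* `hitSet 𝒯 𝒰 = {ω | ω meets every C ∈ 𝒯 ∖ 𝒰}`, `famIn_eq_real_hitSet` (`famIn` is its probability), **`famIn_mul_le_inter`** (HARRIS: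
  `famIn 𝒰 · famIn 𝒱 ≤ famIn (𝒰 ∩ 𝒱)`), `famIn_congr`.
* `cover3_core` — the counting lemma for three transversals (memo §5, by the peeling induction: complementary pairs `{ab}|{c}`,
  the cyclic triple `{12,13,23}`, the triple `{1}|{2}|{3}`, Harris pairs; what is left has total ≤ the maximal load).
* **`cover_three`** (THEOREM 4): for a family `𝒯 = {C₁, C₂, C₃}` of three subsets of the block, the single "safety" inequality
  `famIn {C₁} · famIn {C₂} · famIn {C₃} ≤ (famIn ∅)²` (the only instance of SAFE that is not Harris) implies the COVER PROPERTY
  `Cover p a 𝒯`; with `gsafe_of_cover` this gives graded safety of every safe core with three minimal transversals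
  (e.g. the path core `P₄ = (x₁∨x₃)(x₂∨x₃)(x₂∨x₄)`, the minimal non-read-once core: `…SunflowerCoverP4`).
-/

noncomputable section

namespace Summit.CriticalPhenomena.PercolationContinuityZ3.Theorems.SunflowerPartition

namespace SafeCalc

open MeasureTheory Finset
open Literature.Probability.LatticeModels Literature.Probability.Percolation
open TwoGenCore (wmiss)

variable {ι : Type*} [DecidableEq ι] (p : ι → unitInterval) (a : Finset ι)

/-! ## Hitting events and Harris for `famIn` -/

/-- The event "ω meets every member of `𝒯` outside `𝒰`". [this work] -/
def hitSet (𝒯 𝒰 : Finset (Finset ι)) : Set (Set ι) := {ω | ∀ C ∈ 𝒯, C ∉ 𝒰 → ∃ e ∈ C, e ∈ ω}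

omit [DecidableEq ι] in
/-- Hitting events are up-sets. [this work] -/
theorem isUpperSet_hitSet (𝒯 𝒰 : Finset (Finset ι)) : IsUpperSet (hitSet 𝒯 𝒰) := by
  intro ω ω' hle hω C hC hCU
  obtain ⟨e, he, heω⟩ := hω C hC hCU
  exact ⟨e, he, hle heω⟩

/-- Intersections of hitting events. [this work] -/
theorem hitSet_inter (𝒯 𝒰 𝒱 : Finset (Finset ι)) : hitSet 𝒯 𝒰 ∩ hitSet 𝒯 𝒱 = hitSet 𝒯 (𝒰 ∩ 𝒱) := by
  ext ω
  simp only [hitSet, Set.mem_inter_iff, Set.mem_setOf_eq, mem_inter, not_and_or]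
  constructor
  · rintro ⟨h1, h2⟩ C hC (hU | hV)
    · exact h1 C hC hU
    · exact h2 C hC hV
  · intro h
    exact ⟨fun C hC hU => h C hC (Or.inl hU), fun C hC hV => h C hC (Or.inr hV)⟩

omit [DecidableEq ι] in
/-- Hitting events are determined by the block. [this work] -/
theorem determinedBy_hitSet {𝒯 : Finset (Finset ι)} (h𝒯a : ∀ C ∈ 𝒯, C ⊆ a) (𝒰 : Finset (Finset ι)) :
    DeterminedBy (hitSet 𝒯 𝒰) (↑a : Set ι) := by
  rw [determinedBy_iff]
  intro ω ω' h
  have key : ∀ C ∈ 𝒯, ((∃ e ∈ C, e ∈ ω) ↔ (∃ e ∈ C, e ∈ ω')) := by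
    intro C hC
    constructor
    · rintro ⟨e, he, heω⟩
      have : e ∈ ω' ∩ (↑a : Set ι) := by rw [← h]; exact ⟨heω, Finset.mem_coe.2 (h𝒯a C hC he)⟩
      exact ⟨e, he, this.1⟩
    · rintro ⟨e, he, heω⟩
      have : e ∈ ω ∩ (↑a : Set ι) := by rw [h]; exact ⟨heω, Finset.mem_coe.2 (h𝒯a C hC he)⟩
      exact ⟨e, he, this.1⟩
  simp only [hitSet, Set.mem_setOf_eq]
  exact forall₂_congr fun C hC => imp_congr_right fun _ => key C hC

/-- `famIn` is the probability of the hitting event. [this work] -/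
theorem famIn_eq_real_hitSet [Fintype ι] {𝒯 : Finset (Finset ι)} (h𝒯a : ∀ C ∈ 𝒯, C ⊆ a) (𝒰 : Finset (Finset ι)) :
    famIn p a 𝒯 𝒰 = (prodBernoulli p).real (hitSet 𝒯 𝒰) := by
  classical
  rw [← BEx_indicator_eq_real p (determinedBy_hitSet a h𝒯a 𝒰)]
  unfold famIn
  refine Finset.sum_congr rfl fun T hT => ?_
  rw [mem_powerset] at hT
  congr 1
  have hiff : (∀ C ∈ 𝒯, C ⊆ T → C ∈ 𝒰) ↔ ((a \ T : Finset ι) : Set ι) ∈ hitSet 𝒯 𝒰 := by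
    change _ ↔ ∀ C ∈ 𝒯, C ∉ 𝒰 → ∃ e ∈ C, e ∈ ((a \ T : Finset ι) : Set ι)
    constructor
    · intro h C hC hCU
      by_contra hne
      push Not at hne
      refine hCU (h C hC fun e he => ?_)
      by_contra heT
      exact hne e he (by rw [Finset.mem_coe, Finset.mem_sdiff]; exact ⟨h𝒯a C hC he, heT⟩)
    · intro h C hC hCT
      by_contra hCU
      obtain ⟨e, he, hea⟩ := h C hC hCU
      rw [Finset.mem_coe, Finset.mem_sdiff] at hea
      exact hea.2 (hCT he)
  dsimp only
  by_cases h1 : ∀ C ∈ 𝒯, C ⊆ T → C ∈ 𝒰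
  · rw [if_pos h1, if_pos (hiff.1 h1)]
  · rw [if_neg h1, if_neg (fun h2 => h1 (hiff.2 h2))]

/-- **Harris for the family functional**: `famIn 𝒰 · famIn 𝒱 ≤ famIn (𝒰 ∩ 𝒱)`. [this work] -/
theorem famIn_mul_le_inter [Fintype ι] {𝒯 : Finset (Finset ι)} (h𝒯a : ∀ C ∈ 𝒯, C ⊆ a) (𝒰 𝒱 : Finset (Finset ι)) :
    famIn p a 𝒯 𝒰 * famIn p a 𝒯 𝒱 ≤ famIn p a 𝒯 (𝒰 ∩ 𝒱) := by
  rw [famIn_eq_real_hitSet p a h𝒯a, famIn_eq_real_hitSet p a h𝒯a, famIn_eq_real_hitSet p a h𝒯a, ← hitSet_inter]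
  exact prodBernoulli_harris p (isUpperSet_hitSet 𝒯 𝒰) (isUpperSet_hitSet 𝒯 𝒱) MeasurableSet.of_discrete
    MeasurableSet.of_discrete

/-- `famIn` only sees which members of `𝒯` are allowed. [this work] -/
theorem famIn_congr (𝒯 : Finset (Finset ι)) {𝒰 𝒱 : Finset (Finset ι)} (h : ∀ C ∈ 𝒯, (C ∈ 𝒰 ↔ C ∈ 𝒱)) :
    famIn p a 𝒯 𝒰 = famIn p a 𝒯 𝒱 := by
  unfold famIn
  congr 1; funext T
  have : (∀ C ∈ 𝒯, C ⊆ T → C ∈ 𝒰) ↔ (∀ C ∈ 𝒯, C ⊆ T → C ∈ 𝒱) :=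
    forall₂_congr fun C hC => imp_congr_right fun _ => h C hC
  simp only [this]

/-! ## The counting lemma for three transversals -/

/-- **The counting lemma** (memo §5): with `h = f(∅)`, `f_S = famIn S` for the nonempty proper sub-families of `{1,2,3}`, the Harris
inequalities, the cyclic bound and the one safety inequality `f₁f₂f₃ ≤ h²`, every count vector whose three column loads are at
most `m` satisfies `∏ f_S^{n_S} ≤ h^{N − m}`. [this work] -/
theorem cover3_core {h f1 f2 f3 f12 f13 f23 : ℝ} (hh0 : 0 ≤ h) (hh1 : h ≤ 1)
    (h1 : 0 ≤ f1) (h2 : 0 ≤ f2) (h3 : 0 ≤ f3) (h12 : 0 ≤ f12) (h13 : 0 ≤ f13) (h23 : 0 ≤ f23)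
    (l1 : f1 ≤ 1) (l2 : f2 ≤ 1) (l3 : f3 ≤ 1) (l12 : f12 ≤ 1) (l13 : f13 ≤ 1) (l23 : f23 ≤ 1)
    (P1 : f23 * f1 ≤ h) (P2 : f13 * f2 ≤ h) (P3 : f12 * f3 ≤ h)
    (Q12 : f1 * f2 ≤ h) (Q13 : f1 * f3 ≤ h) (Q23 : f2 * f3 ≤ h)
    (S3 : f1 * f2 * f3 ≤ h ^ 2) (CYC : f12 * f13 * f23 ≤ h) :
    ∀ (N s1 s2 s3 d12 d13 d23 m : ℕ), s1 + s2 + s3 + d12 + d13 + d23 = N →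
      s1 + d12 + d13 ≤ m → s2 + d12 + d23 ≤ m → s3 + d13 + d23 ≤ m →
        f1 ^ s1 * f2 ^ s2 * f3 ^ s3 * f12 ^ d12 * f13 ^ d13 * f23 ^ d23 ≤ h ^ (N - m) := by
  intro N
  induction N using Nat.strong_induction_on with
  | _ N ih =>
  intro s1 s2 s3 d12 d13 d23 m hN L1 L2 L3
  have hV0 : ∀ a b c d e g : ℕ, 0 ≤ f1 ^ a * f2 ^ b * f3 ^ c * f12 ^ d * f13 ^ e * f23 ^ g :=
    fun _ _ _ _ _ _ => by positivity
  have hV1 : ∀ a b c d e g : ℕ, f1 ^ a * f2 ^ b * f3 ^ c * f12 ^ d * f13 ^ e * f23 ^ g ≤ 1 := by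
    intro a b c d e g
    have := pow_le_one₀ h1 l1 (n := a); have := pow_le_one₀ h2 l2 (n := b); have := pow_le_one₀ h3 l3 (n := c)
    have := pow_le_one₀ h12 l12 (n := d); have := pow_le_one₀ h13 l13 (n := e); have := pow_le_one₀ h23 l23 (n := g)
    calc f1 ^ a * f2 ^ b * f3 ^ c * f12 ^ d * f13 ^ e * f23 ^ g ≤ 1 * 1 * 1 * 1 * 1 * 1 := by
          gcongr
      _ = 1 := by ring
  -- the generic peeling step: value = cert * smaller value, cert ≤ h^g, smaller ≤ h^(N' - m'), and N - m ≤ g + (N' - m')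
  have peel : ∀ {cert rest : ℝ} {g N' m' : ℕ}, 0 ≤ rest → cert ≤ h ^ g → rest ≤ h ^ (N' - m') →
      N - m ≤ g + (N' - m') → cert * rest ≤ h ^ (N - m) := by
    intro cert rest g N' m' hrest hcert hrest' hexp
    calc cert * rest ≤ h ^ g * h ^ (N' - m') :=
          mul_le_mul hcert hrest' hrest (pow_nonneg hh0 g)
      _ = h ^ (g + (N' - m')) := (pow_add h g _).symm
      _ ≤ h ^ (N - m) := pow_le_pow_of_le_one hh0 hh1 hexp
  by_cases c1 : 0 < d23 ∧ 0 < s1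
  · obtain ⟨d, rfl⟩ := Nat.exists_eq_succ_of_ne_zero c1.1.ne'
    obtain ⟨s, rfl⟩ := Nat.exists_eq_succ_of_ne_zero c1.2.ne'
    have hrec := ih (N - 2) (by omega) s s2 s3 d12 d13 d (m - 1) (by omega) (by omega) (by omega) (by omega)
    have heq : f1 ^ (s + 1) * f2 ^ s2 * f3 ^ s3 * f12 ^ d12 * f13 ^ d13 * f23 ^ (d + 1) =
        (f23 * f1) * (f1 ^ s * f2 ^ s2 * f3 ^ s3 * f12 ^ d12 * f13 ^ d13 * f23 ^ d) := by ring
    rw [heq]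
    exact peel (hV0 _ _ _ _ _ _) (by rw [pow_one]; exact P1) hrec (by omega)
  by_cases c2 : 0 < d13 ∧ 0 < s2
  · obtain ⟨d, rfl⟩ := Nat.exists_eq_succ_of_ne_zero c2.1.ne'
    obtain ⟨s, rfl⟩ := Nat.exists_eq_succ_of_ne_zero c2.2.ne'
    have hrec := ih (N - 2) (by omega) s1 s s3 d12 d d23 (m - 1) (by omega) (by omega) (by omega) (by omega)
    have heq : f1 ^ s1 * f2 ^ (s + 1) * f3 ^ s3 * f12 ^ d12 * f13 ^ (d + 1) * f23 ^ d23 =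
        (f13 * f2) * (f1 ^ s1 * f2 ^ s * f3 ^ s3 * f12 ^ d12 * f13 ^ d * f23 ^ d23) := by ring
    rw [heq]
    exact peel (hV0 _ _ _ _ _ _) (by rw [pow_one]; exact P2) hrec (by omega)
  by_cases c3 : 0 < d12 ∧ 0 < s3
  · obtain ⟨d, rfl⟩ := Nat.exists_eq_succ_of_ne_zero c3.1.ne'
    obtain ⟨s, rfl⟩ := Nat.exists_eq_succ_of_ne_zero c3.2.ne'
    have hrec := ih (N - 2) (by omega) s1 s2 s d d13 d23 (m - 1) (by omega) (by omega) (by omega) (by omega)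
    have heq : f1 ^ s1 * f2 ^ s2 * f3 ^ (s + 1) * f12 ^ (d + 1) * f13 ^ d13 * f23 ^ d23 =
        (f12 * f3) * (f1 ^ s1 * f2 ^ s2 * f3 ^ s * f12 ^ d * f13 ^ d13 * f23 ^ d23) := by ring
    rw [heq]
    exact peel (hV0 _ _ _ _ _ _) (by rw [pow_one]; exact P3) hrec (by omega)
  by_cases c4 : 0 < d12 ∧ 0 < d13 ∧ 0 < d23
  · obtain ⟨x, rfl⟩ := Nat.exists_eq_succ_of_ne_zero c4.1.ne'
    obtain ⟨y, rfl⟩ := Nat.exists_eq_succ_of_ne_zero c4.2.1.ne'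
    obtain ⟨z, rfl⟩ := Nat.exists_eq_succ_of_ne_zero c4.2.2.ne'
    have hrec := ih (N - 3) (by omega) s1 s2 s3 x y z (m - 2) (by omega) (by omega) (by omega) (by omega)
    have heq : f1 ^ s1 * f2 ^ s2 * f3 ^ s3 * f12 ^ (x + 1) * f13 ^ (y + 1) * f23 ^ (z + 1) =
        (f12 * f13 * f23) * (f1 ^ s1 * f2 ^ s2 * f3 ^ s3 * f12 ^ x * f13 ^ y * f23 ^ z) := by ring
    rw [heq]
    exact peel (hV0 _ _ _ _ _ _) (by rw [pow_one]; exact CYC) hrec (by omega)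
  by_cases c5 : 0 < s1 ∧ 0 < s2 ∧ 0 < s3
  · obtain ⟨x, rfl⟩ := Nat.exists_eq_succ_of_ne_zero c5.1.ne'
    obtain ⟨y, rfl⟩ := Nat.exists_eq_succ_of_ne_zero c5.2.1.ne'
    obtain ⟨z, rfl⟩ := Nat.exists_eq_succ_of_ne_zero c5.2.2.ne'
    have hrec := ih (N - 3) (by omega) x y z d12 d13 d23 (m - 1) (by omega) (by omega) (by omega) (by omega)
    have heq : f1 ^ (x + 1) * f2 ^ (y + 1) * f3 ^ (z + 1) * f12 ^ d12 * f13 ^ d13 * f23 ^ d23 =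
        (f1 * f2 * f3) * (f1 ^ x * f2 ^ y * f3 ^ z * f12 ^ d12 * f13 ^ d13 * f23 ^ d23) := by ring
    rw [heq]
    exact peel (hV0 _ _ _ _ _ _) S3 hrec (by omega)
  by_cases c6 : 0 < s1 ∧ 0 < s2
  · obtain ⟨x, rfl⟩ := Nat.exists_eq_succ_of_ne_zero c6.1.ne'
    obtain ⟨y, rfl⟩ := Nat.exists_eq_succ_of_ne_zero c6.2.ne'
    have hrec := ih (N - 2) (by omega) x y s3 d12 d13 d23 (m - 1) (by omega) (by omega) (by omega) (by omega)
    have heq : f1 ^ (x + 1) * f2 ^ (y + 1) * f3 ^ s3 * f12 ^ d12 * f13 ^ d13 * f23 ^ d23 =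
        (f1 * f2) * (f1 ^ x * f2 ^ y * f3 ^ s3 * f12 ^ d12 * f13 ^ d13 * f23 ^ d23) := by ring
    rw [heq]
    exact peel (hV0 _ _ _ _ _ _) (by rw [pow_one]; exact Q12) hrec (by omega)
  by_cases c7 : 0 < s1 ∧ 0 < s3
  · obtain ⟨x, rfl⟩ := Nat.exists_eq_succ_of_ne_zero c7.1.ne'
    obtain ⟨z, rfl⟩ := Nat.exists_eq_succ_of_ne_zero c7.2.ne'
    have hrec := ih (N - 2) (by omega) x s2 z d12 d13 d23 (m - 1) (by omega) (by omega) (by omega) (by omega)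
    have heq : f1 ^ (x + 1) * f2 ^ s2 * f3 ^ (z + 1) * f12 ^ d12 * f13 ^ d13 * f23 ^ d23 =
        (f1 * f3) * (f1 ^ x * f2 ^ s2 * f3 ^ z * f12 ^ d12 * f13 ^ d13 * f23 ^ d23) := by ring
    rw [heq]
    exact peel (hV0 _ _ _ _ _ _) (by rw [pow_one]; exact Q13) hrec (by omega)
  by_cases c8 : 0 < s2 ∧ 0 < s3
  · obtain ⟨y, rfl⟩ := Nat.exists_eq_succ_of_ne_zero c8.1.ne'
    obtain ⟨z, rfl⟩ := Nat.exists_eq_succ_of_ne_zero c8.2.ne'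
    have hrec := ih (N - 2) (by omega) s1 y z d12 d13 d23 (m - 1) (by omega) (by omega) (by omega) (by omega)
    have heq : f1 ^ s1 * f2 ^ (y + 1) * f3 ^ (z + 1) * f12 ^ d12 * f13 ^ d13 * f23 ^ d23 =
        (f2 * f3) * (f1 ^ s1 * f2 ^ y * f3 ^ z * f12 ^ d12 * f13 ^ d13 * f23 ^ d23) := by ring
    rw [heq]
    exact peel (hV0 _ _ _ _ _ _) (by rw [pow_one]; exact Q23) hrec (by omega)
  -- nothing left to pair: the total is at most the maximal load
  have hNm : N - m = 0 := by omega
  rw [hNm, pow_zero]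
  exact hV1 _ _ _ _ _ _

/-! ## Theorem 4 -/

/-- **THEOREM 4 (three minimal transversals): the one safety inequality `f₁ f₂ f₃ ≤ h²` implies the cover property.**  For a family
`{C₁, C₂, C₃}` of three distinct subsets of the block, if `famIn {C₁} · famIn {C₂} · famIn {C₃} ≤ (famIn ∅)²` then `Cover p a {C₁,C₂,C₃}`
(all other ingredients — Harris merges and the cyclic bound — are automatic). [this work] -/
theorem cover_three [Fintype ι] {C₁ C₂ C₃ : Finset ι} (h12 : C₁ ≠ C₂) (h13 : C₁ ≠ C₃) (h23 : C₂ ≠ C₃)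
    (h𝒯a : ∀ C ∈ ({C₁, C₂, C₃} : Finset (Finset ι)), C ⊆ a)
    (hS3 : famIn p a {C₁, C₂, C₃} {C₁} * famIn p a {C₁, C₂, C₃} {C₂} * famIn p a {C₁, C₂, C₃} {C₃} ≤
      famIn p a {C₁, C₂, C₃} ∅ ^ 2) :
    Cover p a {C₁, C₂, C₃} := by
  classical
  intro K m S hmult
  set 𝒯 : Finset (Finset ι) := {C₁, C₂, C₃} with h𝒯
  have hC₁ : C₁ ∈ 𝒯 := by simp [h𝒯]
  have hC₂ : C₂ ∈ 𝒯 := by simp [h𝒯]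
  have hC₃ : C₃ ∈ 𝒯 := by simp [h𝒯]
  have hmem : ∀ C ∈ 𝒯, C = C₁ ∨ C = C₂ ∨ C = C₃ := fun C hC => by simpa [h𝒯] using hC
  have hne : C₁ ≠ C₂ ∧ C₁ ≠ C₃ ∧ C₂ ≠ C₃ ∧ C₂ ≠ C₁ ∧ C₃ ≠ C₁ ∧ C₃ ≠ C₂ :=
    ⟨h12, h13, h23, h12.symm, h13.symm, h23.symm⟩
  -- the six values and the Harris / cyclic inequalities
  set h := famIn p a 𝒯 ∅ with hh
  set f1 := famIn p a 𝒯 {C₁} with hf1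
  set f2 := famIn p a 𝒯 {C₂} with hf2
  set f3 := famIn p a 𝒯 {C₃} with hf3
  set f12 := famIn p a 𝒯 {C₁, C₂} with hf12
  set f13 := famIn p a 𝒯 {C₁, C₃} with hf13
  set f23 := famIn p a 𝒯 {C₂, C₃} with hf23
  have merge : ∀ 𝒰 𝒱 𝒲 : Finset (Finset ι), (∀ C ∈ 𝒯, (C ∈ 𝒰 ∩ 𝒱 ↔ C ∈ 𝒲)) →
      famIn p a 𝒯 𝒰 * famIn p a 𝒯 𝒱 ≤ famIn p a 𝒯 𝒲 := by
    intro 𝒰 𝒱 𝒲 hW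
    rw [← famIn_congr p a 𝒯 hW]
    exact famIn_mul_le_inter p a h𝒯a 𝒰 𝒱
  have P1 : f23 * f1 ≤ h := merge _ _ _ fun C hC => by
    rcases hmem C hC with rfl | rfl | rfl <;> simp [hne]
  have P2 : f13 * f2 ≤ h := merge _ _ _ fun C hC => by
    rcases hmem C hC with rfl | rfl | rfl <;> simp [hne]
  have P3 : f12 * f3 ≤ h := merge _ _ _ fun C hC => by
    rcases hmem C hC with rfl | rfl | rfl <;> simp [hne]
  have Q12 : f1 * f2 ≤ h := merge _ _ _ fun C hC => by
    rcases hmem C hC with rfl | rfl | rfl <;> simp [hne]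
  have Q13 : f1 * f3 ≤ h := merge _ _ _ fun C hC => by
    rcases hmem C hC with rfl | rfl | rfl <;> simp [hne]
  have Q23 : f2 * f3 ≤ h := merge _ _ _ fun C hC => by
    rcases hmem C hC with rfl | rfl | rfl <;> simp [hne]
  have M1 : f12 * f13 ≤ f1 := merge _ _ _ fun C hC => by
    rcases hmem C hC with rfl | rfl | rfl <;> simp [hne]
  have CYC : f12 * f13 * f23 ≤ h :=
    calc f12 * f13 * f23 ≤ f1 * f23 := mul_le_mul_of_nonneg_right M1 (famIn_nonneg p a 𝒯 _)
      _ = f23 * f1 := mul_comm _ _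
      _ ≤ h := P1
  -- patterns and counts
  let pat : Fin K → Bool × Bool × Bool := fun k => (decide (C₁ ∈ S k), decide (C₂ ∈ S k), decide (C₃ ∈ S k))
  let bset : Bool × Bool × Bool → Finset (Finset ι) := fun b =>
    (bif b.1 then {C₁} else ∅) ∪ (bif b.2.1 then {C₂} else ∅) ∪ (bif b.2.2 then {C₃} else ∅)
  have mem_bif : ∀ (b : Bool) (x : Finset ι) (s : Finset (Finset ι)), x ∈ (bif b then s else ∅) ↔ (b = true ∧ x ∈ s) := by
    intro b x s; cases b <;> simp
  have hval : ∀ k, famIn p a 𝒯 (S k) = famIn p a 𝒯 (bset (pat k)) := by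
    intro k; refine famIn_congr p a 𝒯 fun C hC => ?_
    obtain hC' | hC' | hC' := hmem C hC <;> subst C <;> simp [bset, pat, mem_bif, hne]
  let n : Bool × Bool × Bool → ℕ := fun b => (univ.filter fun k => pat k = b).card
  let G : Bool × Bool × Bool → ℝ := fun b => famIn p a 𝒯 (bset b)
  have hprod : ∏ k, famIn p a 𝒯 (S k) = ∏ b : Bool × Bool × Bool, G b ^ n b := by
    rw [prod_congr rfl fun k _ => hval k,
      ← prod_fiberwise_of_maps_to (s := univ) (t := (univ : Finset (Bool × Bool × Bool))) (g := pat) fun k _ => mem_univ _]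
    refine prod_congr rfl fun b _ => ?_
    rw [prod_congr rfl fun k hk => by rw [(mem_filter.1 hk).2], prod_const]
  -- the eight values
  have vTTT : G (true, true, true) = 1 := by
    have : famIn p a 𝒯 (bset (true, true, true)) = famIn p a 𝒯 𝒯 := famIn_congr p a 𝒯 fun C hC => by
      rcases hmem C hC with rfl | rfl | rfl <;> simp [bset, h𝒯]
    change famIn p a 𝒯 (bset (true, true, true)) = 1
    rw [this, famIn_self]
  have vTTF : G (true, true, false) = f12 := famIn_congr p a 𝒯 fun C hC => by
    rcases hmem C hC with rfl | rfl | rfl <;> simp [bset, hne]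
  have vTFT : G (true, false, true) = f13 := famIn_congr p a 𝒯 fun C hC => by
    rcases hmem C hC with rfl | rfl | rfl <;> simp [bset, hne]
  have vTFF : G (true, false, false) = f1 := famIn_congr p a 𝒯 fun C hC => by
    rcases hmem C hC with rfl | rfl | rfl <;> simp [bset, hne]
  have vFTT : G (false, true, true) = f23 := famIn_congr p a 𝒯 fun C hC => by
    rcases hmem C hC with rfl | rfl | rfl <;> simp [bset, hne]
  have vFTF : G (false, true, false) = f2 := famIn_congr p a 𝒯 fun C hC => by
    rcases hmem C hC with rfl | rfl | rfl <;> simp [bset, hne]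
  have vFFT : G (false, false, true) = f3 := famIn_congr p a 𝒯 fun C hC => by
    rcases hmem C hC with rfl | rfl | rfl <;> simp [bset, hne]
  have vFFF : G (false, false, false) = h := famIn_congr p a 𝒯 fun C hC => by
    rcases hmem C hC with rfl | rfl | rfl <;> simp [bset]
  -- expansion over the eight patterns
  have hexp : ∏ b : Bool × Bool × Bool, G b ^ n b =
      G (true, true, true) ^ n (true, true, true) * G (true, true, false) ^ n (true, true, false) *
      G (true, false, true) ^ n (true, false, true) * G (true, false, false) ^ n (true, false, false) *
      G (false, true, true) ^ n (false, true, true) * G (false, true, false) ^ n (false, true, false) *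
      G (false, false, true) ^ n (false, false, true) * G (false, false, false) ^ n (false, false, false) := by
    simp only [Fintype.prod_prod_type, Fintype.prod_bool]; ring
  -- total count and loads
  have hK : n (true, true, true) + n (true, true, false) + n (true, false, true) + n (true, false, false) +
      n (false, true, true) + n (false, true, false) + n (false, false, true) + n (false, false, false) = K := by
    have h1 := card_eq_sum_card_fiberwise (s := (univ : Finset (Fin K))) (t := (univ : Finset (Bool × Bool × Bool)))
      (f := pat) fun k _ => mem_univ _
    rw [card_univ, Fintype.card_fin] at h1
    rw [h1]
    simp only [Fintype.sum_prod_type, Fintype.sum_bool]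
    ring
  have hloadP : ∀ (P : Bool × Bool × Bool → Prop) [DecidablePred P],
      (univ.filter fun k => P (pat k)).card = ∑ b ∈ univ.filter P, n b := by
    intro P _
    rw [card_eq_sum_card_fiberwise (f := pat) (t := univ.filter P) fun k hk => by
      have hk' : k ∈ univ.filter fun k => P (pat k) := hk
      rw [mem_filter] at hk'
      exact Finset.mem_coe.2 (mem_filter.2 ⟨mem_univ _, hk'.2⟩)]
    refine sum_congr rfl fun b hb => ?_
    rw [mem_filter] at hb
    congr 1
    ext k
    simp only [mem_filter, mem_univ, true_and]
    exact ⟨fun hk => hk.2, fun hk => ⟨hk ▸ hb.2, hk⟩⟩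
  have hL1 : n (true, true, true) + n (true, true, false) + n (true, false, true) + n (true, false, false) ≤ m := by
    have h1 := hmult C₁ hC₁
    have h2 : (univ.filter fun k => C₁ ∈ S k) = univ.filter fun k => (fun b : Bool × Bool × Bool => b.1 = true) (pat k) := by
      ext k; simp [pat]
    rw [h2, hloadP (fun b : Bool × Bool × Bool => b.1 = true)] at h1
    rw [sum_filter] at h1
    simp only [Fintype.sum_prod_type, Fintype.sum_bool] at h1
    simpa [add_assoc] using h1
  have hL2 : n (true, true, true) + n (true, true, false) + n (false, true, true) + n (false, true, false) ≤ m := by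
    have h1 := hmult C₂ hC₂
    have h2 : (univ.filter fun k => C₂ ∈ S k) = univ.filter fun k => (fun b : Bool × Bool × Bool => b.2.1 = true) (pat k) := by
      ext k; simp [pat]
    rw [h2, hloadP (fun b : Bool × Bool × Bool => b.2.1 = true)] at h1
    rw [sum_filter] at h1
    simp only [Fintype.sum_prod_type, Fintype.sum_bool] at h1
    simpa [add_assoc] using h1
  have hL3 : n (true, true, true) + n (true, false, true) + n (false, true, true) + n (false, false, true) ≤ m := by
    have h1 := hmult C₃ hC₃
    have h2 : (univ.filter fun k => C₃ ∈ S k) = univ.filter fun k => (fun b : Bool × Bool × Bool => b.2.2 = true) (pat k) := by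
      ext k; simp [pat]
    rw [h2, hloadP (fun b : Bool × Bool × Bool => b.2.2 = true)] at h1
    rw [sum_filter] at h1
    simp only [Fintype.sum_prod_type, Fintype.sum_bool] at h1
    simpa [add_assoc] using h1
  -- the counting lemma (full patterns lower the capacity, empty ones contribute `h` each)
  have hh0 : 0 ≤ h := famIn_nonneg p a 𝒯 _
  have hh1 : h ≤ 1 := famIn_le_one p a 𝒯 _
  have core := cover3_core hh0 hh1 (famIn_nonneg p a 𝒯 _) (famIn_nonneg p a 𝒯 _) (famIn_nonneg p a 𝒯 _)
    (famIn_nonneg p a 𝒯 _) (famIn_nonneg p a 𝒯 _) (famIn_nonneg p a 𝒯 _)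
    (famIn_le_one p a 𝒯 _) (famIn_le_one p a 𝒯 _) (famIn_le_one p a 𝒯 _) (famIn_le_one p a 𝒯 _)
    (famIn_le_one p a 𝒯 _) (famIn_le_one p a 𝒯 _) P1 P2 P3 Q12 Q13 Q23 hS3 CYC _
    (n (true, false, false)) (n (false, true, false)) (n (false, false, true))
    (n (true, true, false)) (n (true, false, true)) (n (false, true, true)) (m - n (true, true, true)) rfl
    (by omega) (by omega) (by omega)
  rw [hprod, hexp, vTTT, vTTF, vTFT, vTFF, vFTT, vFTF, vFFT, vFFF, one_pow, one_mul]
  have hfinal : h ^ n (false, false, false) *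
      (f1 ^ n (true, false, false) * f2 ^ n (false, true, false) * f3 ^ n (false, false, true) *
        f12 ^ n (true, true, false) * f13 ^ n (true, false, true) * f23 ^ n (false, true, true)) ≤ h ^ (K - m) := by
    calc h ^ n (false, false, false) * (f1 ^ n (true, false, false) * f2 ^ n (false, true, false) * f3 ^ n (false, false, true) *
          f12 ^ n (true, true, false) * f13 ^ n (true, false, true) * f23 ^ n (false, true, true))
        ≤ h ^ n (false, false, false) * h ^ (n (true, false, false) + n (false, true, false) + n (false, false, true) +
            n (true, true, false) + n (true, false, true) + n (false, true, true) - (m - n (true, true, true))) :=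
          mul_le_mul_of_nonneg_left core (pow_nonneg hh0 _)
      _ = h ^ (n (false, false, false) + (n (true, false, false) + n (false, true, false) + n (false, false, true) +
            n (true, true, false) + n (true, false, true) + n (false, true, true) - (m - n (true, true, true)))) := (pow_add h _ _).symm
      _ ≤ h ^ (K - m) := pow_le_pow_of_le_one hh0 hh1 (by omega)
  calc f12 ^ n (true, true, false) * f13 ^ n (true, false, true) * f1 ^ n (true, false, false) *
        f23 ^ n (false, true, true) * f2 ^ n (false, true, false) * f3 ^ n (false, false, true) * h ^ n (false, false, false)
      = h ^ n (false, false, false) * (f1 ^ n (true, false, false) * f2 ^ n (false, true, false) * f3 ^ n (false, false, true) *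
          f12 ^ n (true, true, false) * f13 ^ n (true, false, true) * f23 ^ n (false, true, true)) := by ring
    _ ≤ h ^ (K - m) := hfinal
    _ = famIn p a 𝒯 ∅ ^ (K - m) := by rw [hh]

end SafeCalc

end Summit.CriticalPhenomena.PercolationContinuityZ3.Theorems.SunflowerPartition
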